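import Summits.QuantumFields.YangMills.Theorems.IR.VolumeMonotoneSpectralFloorSeq
import HarnessLib

/-!
# Crux `IR` (stmt-QuantumFields-19354), line `ym-ir7-volume-monotone-gap` (ideator ym-ir-idea-7), input T-GAP-FINITE-sc —
# part 1b: a lag-one covariance floor on ONE periodic chain bounds ALL trace excesses from below (abstract transfer operators)

Helper module for item `stmt-QuantumFields-19354` (`--supports … --as helper`; it closes nothing by itself).  Pooled prover
ym-ir-line-pool-p3 (g5).  Abstract setting of the tree's transfer-operator toolkit (`Literature/Analysis/OperatorTheory`): a
probability space `(X, μ)`, a bounded symmetric strongly measurable kernel `K`, its `L²` operator `A` (`A φ =ᵐ ∫ K(·,y) φ(y)`),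
a countable Hilbert basis of eigenvectors `A bᵢ = λᵢ bᵢ` with `0 ≤ λᵢ ≤ λ_{i₀}`, `0 < λ_{i₀}`, and a bounded measurable one-site
weight `f` (`|f| ≤ p`).  Writing `rᵢ = λᵢ/λ_{i₀}`, `x_s = Σ_{i ≠ i₀} rᵢ^s` (the trace excess of the chain of period `s`),
`ψ =ᵐ f·b_{i₀} ∈ L²`, `c_j = ⟪b_j, ψ⟫` and `V = ⟪ψ, Aψ⟫/λ_{i₀} − c_{i₀}² = Σ_{j ≠ i₀} r_j c_j²` (the lag-one "vacuum
covariance" of `f`), this file PROVES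

(over part 1a `VolumeMonotoneSpectralFloorSeq`: the Jensen-free Hölder step `(V/p²)^s ≤ x_s` on sequences, Parseval for `⟪φ, Aφ⟫`, the
`L²` vectors `f·bᵢ`, the thermal arithmetic)
* `pow_vacuumCov_le_offTop` (**S1**) — `(V/p²)^s ≤ x_s` for all `s ≥ 1`;
* `torusCov_le_vacuumCov` (**S2**) — on the periodic chain of `t = M + 3` sites the normalised lag-one covariance
  `I_t/Z_t − (J_t/Z_t)²` (`I_t`, `J_t` the cyclic integrals with `f` inserted at sites `0,1`, resp. `0`; `Z_t = Σ λᵢ^t`) is at most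
  `V + 3p² x_t + p² x_{t−1}` — the thermal corrections are the trace excesses of the SAME chain.

Consumers: part 2 (`VolumeMonotoneTraceExcessFloor`) feeds the tree's volume-uniform strong-coupling facing-plaquette floor
(`SCFloor.facingPlaquetteCorr_floor_latticeRep`) and cold-pressure bound (`coldPressureBound_strongCoupling_log`) through S2 and S1 to
get `traceExcess r.ρ β (2S+1) (m+2) ≥ (c′β⁴)^{m+2}` on the engine window — the content of the line's input `TraceExcessFloorSC`.

HONEST FRAMING: operator-theoretic bookkeeping; nothing here bears on weak coupling, `BalabanLadder.IR`, or the Yang–Mills mass gap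
(Clay); R4 of the ladder closes only the conditional finite-𝕋⁴ rung `BalabanLadder.UV`.
Refs: M. Reed, B. Simon, *Methods of Modern Mathematical Physics I*, Thm. VI.22–23 (Hilbert–Schmidt eigen-expansion); I. Montvay,
G. Münster, *Quantum Fields on a Lattice* (1994), §1.5.2 (1.195)–(1.196) (transfer-matrix form of periodic-lattice correlators).
-/

set_option autoImplicit false

noncomputable section

open MeasureTheory Filter Set Function
open scoped RealInnerProductSpace ENNReal Topology
open Literature.Analysis.OperatorTheory
open Summit.QuantumFields.YangMills.Cruxes.IR.VacuumEscape.Spectral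
  (hasSum_cyclic_insert_fg inner_fgOp_eq inner_fgOp_one_eq stronglyMeasurable_fgKernel norm_fgKernel_le)

namespace Summit.QuantumFields.YangMills.Cruxes.IR.VolumeMonotone.SpectralFloor

/-! ## §5 The two abstract theorems: S1 (vacuum floor ⇒ excess floor) and S2 (torus covariance ⇒ vacuum floor) -/

section Main

variable {X : Type*} [MeasurableSpace X] {μ : Measure X} [IsProbabilityMeasure μ]
  {K : X → X → ℝ} {C : ℝ} {A : Lp ℝ 2 μ →L[ℝ] Lp ℝ 2 μ} {ι : Type*} [Countable ι] [DecidableEq ι]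
  {b : HilbertBasis ι ℝ (Lp ℝ 2 μ)} {lam : ι → ℝ} {i₀ : ι}

omit [IsProbabilityMeasure μ] [Countable ι] in
/-- **S1 — a vacuum lag-one covariance floor bounds every trace excess from below.**  With `ψ =ᵐ f·b_{i₀}`, `|f| ≤ p`,
`V = ⟪ψ, Aψ⟫/λ_{i₀} − ⟪b_{i₀}, ψ⟫²` (`= Σ_{j≠i₀} (λ_j/λ_{i₀}) ⟪b_j, ψ⟫²`): for every `s ≥ 1`,
`(V/p²)^s ≤ x_s := Σ_{j≠i₀} (λ_j/λ_{i₀})^s`. [folklore] -/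
theorem pow_vacuumCov_le_offTop (hsa : IsSelfAdjoint A) (hb : ∀ i, A (b i) = lam i • b i)
    (hlam0 : ∀ i, 0 ≤ lam i) (hL0 : 0 < lam i₀) {f : X → ℝ} {p : ℝ} (hp : 0 < p) (hfp : ∀ x, ‖f x‖ ≤ p)
    {ψ : Lp ℝ 2 μ} (hψ : (ψ : X → ℝ) =ᵐ[μ] fun x => f x * b i₀ x) {s : ℕ} (hs : s ≠ 0) {xs : ℝ}
    (hxs : HasSum (update (fun i => (lam i / lam i₀) ^ s) i₀ 0) xs) :
    ((⟪ψ, A ψ⟫ / lam i₀ - ⟪b i₀, ψ⟫ ^ 2) / p ^ 2) ^ s ≤ xs := by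
  -- weights `w_j = ⟪b_j, ψ⟫²`, `W = ‖ψ‖² − w_{i₀} ≤ p²`, `V = Σ_{j≠i₀} r_j w_j`
  have hW : HasSum (update (fun j => ⟪b j, ψ⟫ ^ 2) i₀ 0) (0 - ⟪b i₀, ψ⟫ ^ 2 + ‖ψ‖ ^ 2) :=
    (hasSum_inner_sq b ψ).update i₀ 0
  have hQ : HasSum (fun j => lam j / lam i₀ * ⟪b j, ψ⟫ ^ 2) (⟪ψ, A ψ⟫ / lam i₀) := by
    refine ((hasSum_lam_mul_inner_sq hsa hb ψ).div_const (lam i₀)).congr_fun fun j => ?_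
    ring
  have hV : HasSum (update (fun j => lam j / lam i₀ * ⟪b j, ψ⟫ ^ 2) i₀ 0)
      (0 - lam i₀ / lam i₀ * ⟪b i₀, ψ⟫ ^ 2 + ⟪ψ, A ψ⟫ / lam i₀) := hQ.update i₀ 0
  rw [div_self hL0.ne', one_mul] at hV
  have hWP : 0 - ⟪b i₀, ψ⟫ ^ 2 + ‖ψ‖ ^ 2 ≤ p ^ 2 := by
    have h1 : ‖ψ‖ ^ 2 ≤ p ^ 2 * ‖b i₀‖ ^ 2 := norm_sq_mulLp_le hfp hψ
    rw [b.orthonormal.norm_eq_one i₀, one_pow, mul_one] at h1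
    nlinarith [sq_nonneg ⟪b i₀, ψ⟫]
  have h := div_pow_le_offTop (i₀ := i₀) (r := fun j => lam j / lam i₀) (w := fun j => ⟪b j, ψ⟫ ^ 2)
    (fun j => div_nonneg (hlam0 j) hL0.le) (fun j => sq_nonneg _) hs hxs hW hV (pow_pos hp 2) hWP
  have he : ⟪ψ, A ψ⟫ / lam i₀ - ⟪b i₀, ψ⟫ ^ 2 = 0 - ⟪b i₀, ψ⟫ ^ 2 + ⟪ψ, A ψ⟫ / lam i₀ := by ring
  rw [he]
  exact h

/-- **S2 — the lag-one covariance of ONE periodic chain controls the vacuum covariance up to trace excesses.**  On the chain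
of `t = M + 3` sites with kernel `K` and eigen-data `(bᵢ, λᵢ)`, `0 ≤ λᵢ ≤ λ_{i₀}`, `0 < λ_{i₀}`: with
`I = ∫ ∏K · f(W₀)f(W₁)`, `J = ∫ ∏K · f(W₀)`, `Z_t = Σ λᵢ^t`, `Z_{t−1} = Σ λᵢ^{t−1}`, `x_t = Z_t/λ_{i₀}^t − 1`,
`x_{t−1} = Z_{t−1}/λ_{i₀}^{t−1} − 1` and `ψ =ᵐ f·b_{i₀}`:
`I/Z_t − (J/Z_t)² − 3p² x_t − p² x_{t−1} ≤ ⟪ψ, Aψ⟫/λ_{i₀} − ⟪b_{i₀}, ψ⟫²`. [folklore] -/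
theorem torusCov_le_vacuumCov (hK : StronglyMeasurable (uncurry K)) (hC : ∀ x y, ‖K x y‖ ≤ C)
    (hsymm : ∀ x y, K x y = K y x) (hA : ∀ φ : Lp ℝ 2 μ, (A φ : X → ℝ) =ᵐ[μ] fun x => ∫ y, K x y * φ y ∂μ)
    (hb : ∀ i, A (b i) = lam i • b i) (hlam0 : ∀ i, 0 ≤ lam i) (hle : ∀ i, lam i ≤ lam i₀) (hL0 : 0 < lam i₀)
    {f : X → ℝ} (hf : Measurable f) {p : ℝ} (hp : 0 < p) (hfp : ∀ x, ‖f x‖ ≤ p)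
    {ψ : Lp ℝ 2 μ} (hψ : (ψ : X → ℝ) =ᵐ[μ] fun x => f x * b i₀ x) (M : ℕ) {Zt Zt' : ℝ}
    (hZt : HasSum (fun i => lam i ^ (M + 3)) Zt) (hZt' : HasSum (fun i => lam i ^ (M + 2)) Zt') :
    (∫ W : Fin (M + 1 + 2) → X, (∏ t, K (W t) (W (t + 1))) * (f (W 0) * f (W 1)) ∂(Measure.pi fun _ => μ)) / Zt -
        ((∫ W : Fin (M + 1 + 2) → X, (∏ t, K (W t) (W (t + 1))) * f (W 0) ∂(Measure.pi fun _ => μ)) / Zt) ^ 2 -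
        3 * p ^ 2 * (Zt / lam i₀ ^ (M + 3) - 1) - p ^ 2 * (Zt' / lam i₀ ^ (M + 2) - 1) ≤
      ⟪ψ, A ψ⟫ / lam i₀ - ⟪b i₀, ψ⟫ ^ 2 := by
  have hsa : IsSelfAdjoint A := isSelfAdjoint_kernelOp hK hC hsymm hA
  -- the insertion operators `𝒳_{f,f}`, `𝒳_{f,1}`
  have h1m : Measurable (fun _ : X => (1 : ℝ)) := measurable_const
  have h1b : ∀ x : X, ‖(fun _ : X => (1 : ℝ)) x‖ ≤ 1 := fun x => by simp
  obtain ⟨Xff, hXff⟩ := exists_kernelOp (μ := μ) (stronglyMeasurable_fgKernel hK hf hf)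
    (norm_fgKernel_le hC hfp hfp)
  obtain ⟨Xf1, hXf1⟩ := exists_kernelOp (μ := μ) (stronglyMeasurable_fgKernel hK hf h1m)
    (norm_fgKernel_le hC hfp h1b)
  -- the cyclic integrals as spectral sums
  have hI := hasSum_cyclic_insert_fg (b := b) hK hC hsymm hA hb hf hf hfp hfp hXff M
  have hJ' := hasSum_cyclic_insert_fg (b := b) hK hC hsymm hA hb hf h1m hfp h1b hXf1 M
  have hJ : HasSum (fun i => lam i ^ (M + 2) * ⟪b i, Xf1 (b i)⟫)
      (∫ W : Fin (M + 1 + 2) → X, (∏ t, K (W t) (W (t + 1))) * f (W 0) ∂(Measure.pi fun _ => μ)) := by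
    simpa only [mul_one] using hJ'
  -- the vectors `ψ_i =ᵐ f·b_i` and the matrix elements
  have hex := fun i => exists_Lp_mul (μ := μ) hf hfp (b i)
  choose ψs hψs using hex
  set d : ι → ℝ := fun i => ⟪b i, ψs i⟫ with hd
  have hdi : ∀ i, ⟪b i, Xf1 (b i)⟫ = lam i * d i := fun i => by
    have hd' : d i = ∫ x, b i x * (f x * b i x) ∂μ := inner_mulLp_eq (hψs i) (b i)
    rw [inner_fgOp_one_eq (μ := μ) (K := K) (b := b) hA hb hXf1 i, hd']
    congr 1
    refine integral_congr_ae (Eventually.of_forall fun x => ?_)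
    simp only; ring
  have hQi : ∀ i, ⟪b i, Xff (b i)⟫ = ⟪ψs i, A (ψs i)⟫ := fun i => by
    rw [inner_fgOp_eq (μ := μ) (K := K) (b := b) hXff i, inner_mulLp_apply_eq hA (hψs i)]
  -- bounds on the matrix elements
  have hdp : ∀ i, |d i| ≤ p := fun i => by
    have h1 : |⟪b i, ψs i⟫| ≤ ‖b i‖ * ‖ψs i‖ := abs_real_inner_le_norm _ _
    have h2 : ‖ψs i‖ ^ 2 ≤ p ^ 2 * ‖b i‖ ^ 2 := norm_sq_mulLp_le hfp (hψs i)
    rw [b.orthonormal.norm_eq_one i, one_mul] at h1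
    rw [b.orthonormal.norm_eq_one i, one_pow, mul_one] at h2
    have h3 : ‖ψs i‖ ≤ p := (pow_le_pow_iff_left₀ (norm_nonneg _) hp.le two_ne_zero).1 h2
    exact h1.trans h3
  have hQ0 : ∀ i, 0 ≤ ⟪b i, Xff (b i)⟫ := fun i => by
    rw [hQi i]; exact (inner_apply_nonneg_le hsa hb hlam0 hle (ψs i)).1
  have hQp : ∀ i, ⟪b i, Xff (b i)⟫ / lam i₀ ≤ p ^ 2 := fun i => by
    rw [hQi i, div_le_iff₀ hL0]
    have h2 : ‖ψs i‖ ^ 2 ≤ p ^ 2 * ‖b i‖ ^ 2 := norm_sq_mulLp_le hfp (hψs i)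
    rw [b.orthonormal.norm_eq_one i, one_pow, mul_one] at h2
    have h3 := (inner_apply_nonneg_le hsa hb hlam0 hle (ψs i)).2
    nlinarith [mul_le_mul_of_nonneg_left h2 hL0.le]
  -- `ψs i₀ = ψ` in `L²`
  have hψψ : ψs i₀ = ψ := Lp.ext ((hψs i₀).trans hψ.symm)
  -- normalised spectral sums: ratios `r_i = λ_i/λ_{i₀}`
  set L : ℝ := lam i₀ with hLdef
  have hLt : L ^ (M + 3) ≠ 0 := pow_ne_zero _ hL0.ne'
  set r : ι → ℝ := fun i => lam i / L with hr
  have hr0 : ∀ i, 0 ≤ r i := fun i => div_nonneg (hlam0 i) hL0.le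
  have hri₀ : r i₀ = 1 := div_self hL0.ne'
  have hlamr : ∀ i (n : ℕ), lam i ^ n / L ^ n = r i ^ n := fun i n => by rw [hr, div_pow]
  -- `x_t`, `x_{t−1}` as off-top sums
  set xt : ℝ := Zt / L ^ (M + 3) - 1 with hxt
  set xt' : ℝ := Zt' / L ^ (M + 2) - 1 with hxt'
  have hxt_sum : HasSum (update (fun i => r i ^ (M + 3)) i₀ 0) xt := by
    have h1 : HasSum (fun i => r i ^ (M + 3)) (Zt / L ^ (M + 3)) :=
      (hZt.div_const _).congr_fun fun i => (hlamr i _).symm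
    have h2 := h1.update i₀ 0
    rw [hri₀, one_pow] at h2
    have e : (0 : ℝ) - 1 + Zt / L ^ (M + 3) = xt := by rw [hxt]; ring
    rwa [e] at h2
  have hxt'_sum : HasSum (update (fun i => r i ^ (M + 2)) i₀ 0) xt' := by
    have h1 : HasSum (fun i => r i ^ (M + 2)) (Zt' / L ^ (M + 2)) :=
      (hZt'.div_const _).congr_fun fun i => (hlamr i _).symm
    have h2 := h1.update i₀ 0
    rw [hri₀, one_pow] at h2
    have e : (0 : ℝ) - 1 + Zt' / L ^ (M + 2) = xt' := by rw [hxt']; ring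
    rwa [e] at h2
  have hxt0 : 0 ≤ xt := nonneg_of_hasSum_update (fun k => pow_nonneg (hr0 k) _) hxt_sum
  have hxt'0 : 0 ≤ xt' := nonneg_of_hasSum_update (fun k => pow_nonneg (hr0 k) _) hxt'_sum
  -- the normalised two-point insertion `Ĩ = I/λ₀^t = Σ r_i^{t−1} (Q_i/λ₀)`
  set I : ℝ := ∫ W : Fin (M + 1 + 2) → X, (∏ t, K (W t) (W (t + 1))) * (f (W 0) * f (W 1))
    ∂(Measure.pi fun _ => μ) with hIdef
  set J : ℝ := ∫ W : Fin (M + 1 + 2) → X, (∏ t, K (W t) (W (t + 1))) * f (W 0)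
    ∂(Measure.pi fun _ => μ) with hJdef
  have hIn : HasSum (fun i => r i ^ (M + 2) * (⟪b i, Xff (b i)⟫ / L)) (I / L ^ (M + 3)) := by
    refine (hI.div_const (L ^ (M + 3))).congr_fun fun i => ?_
    rw [← hlamr i (M + 2)]
    field_simp
    ring
  have hIoff := hIn.update i₀ 0
  rw [hri₀, one_pow, one_mul] at hIoff
  have hIle : 0 - ⟪b i₀, Xff (b i₀)⟫ / L + I / L ^ (M + 3) ≤ p ^ 2 * xt' :=
    offTop_mul_le (fun k => pow_nonneg (hr0 k) _) (fun j _ => hQp j) hxt'_sum hIoff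
  -- the normalised one-point insertion `J̃ = J/λ₀^t = Σ r_i^t d_i`
  have hJn : HasSum (fun i => r i ^ (M + 3) * d i) (J / L ^ (M + 3)) := by
    refine (hJ.div_const (L ^ (M + 3))).congr_fun fun i => ?_
    rw [hdi i, ← hlamr i (M + 3)]
    ring
  have hJoff := hJn.update i₀ 0
  rw [hri₀, one_pow, one_mul] at hJoff
  have hEle : |0 - d i₀ + J / L ^ (M + 3)| ≤ p * xt :=
    abs_offTop_mul_le (fun k => pow_nonneg (hr0 k) _) hdp hxt_sum hJoff
  -- the vacuum covariance `V ≥ 0`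
  have hd₀ : d i₀ = ⟪b i₀, ψ⟫ := by
    show ⟪b i₀, ψs i₀⟫ = ⟪b i₀, ψ⟫
    rw [hψψ]
  have hQ₀ : ⟪b i₀, Xff (b i₀)⟫ / L = ⟪ψ, A ψ⟫ / L := by rw [hQi i₀, hψψ]
  have hV0 : 0 ≤ ⟪ψ, A ψ⟫ / L - ⟪b i₀, ψ⟫ ^ 2 := by
    have hQ : HasSum (fun j => lam j / L * ⟪b j, ψ⟫ ^ 2) (⟪ψ, A ψ⟫ / L) := by
      refine ((hasSum_lam_mul_inner_sq hsa hb ψ).div_const L).congr_fun fun j => ?_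
      ring
    have hV := hQ.update i₀ 0
    rw [show lam i₀ / L = 1 from div_self hL0.ne', one_mul] at hV
    have := nonneg_of_hasSum_update (i₀ := i₀) (u := fun j => lam j / L * ⟪b j, ψ⟫ ^ 2)
      (fun j => mul_nonneg (div_nonneg (hlam0 j) hL0.le) (sq_nonneg _)) hV
    linarith
  -- the arithmetic
  have hmain := cov_sub_le_of_bounds (I := I / L ^ (M + 3)) (J := J / L ^ (M + 3)) (Z := Zt / L ^ (M + 3))
    (x := xt) (x' := xt') (d₀ := d i₀) (E := 0 - d i₀ + J / L ^ (M + 3)) (V := ⟪ψ, A ψ⟫ / L - ⟪b i₀, ψ⟫ ^ 2)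
    (p := p) (by rw [hxt]; ring) hxt0 hxt'0 (hdp i₀) hEle (by ring) (by rw [hd₀, ← hQ₀]; linarith) hV0
  have hIZ : I / L ^ (M + 3) / (Zt / L ^ (M + 3)) = I / Zt := div_div_div_cancel_right₀ hLt _ _
  have hJZ : J / L ^ (M + 3) / (Zt / L ^ (M + 3)) = J / Zt := div_div_div_cancel_right₀ hLt _ _
  rw [hIZ, hJZ] at hmain
  exact hmain

end Main

end Summit.QuantumFields.YangMills.Cruxes.IR.VolumeMonotone.SpectralFloor

end
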